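import Mathlib.Analysis.Calculus.ContDiff.FiniteDimension
import Literature.Analysis.Calculus.MultilinearComponentBounds
import HarnessLib

/-!
# One more derivative from the partial derivatives along an orthonormal basis

Topic `Literature/Analysis/Calculus`. Let `E` be a finite-dimensional real inner product space
with an orthonormal basis `(e_k)_{k ∈ ι}`, `s ⊆ E` open and `v : E → F` differentiable on `s`
with partial derivatives `∂_k v = (x ↦ Dv(x) e_k)`.

* `clm_apply_eq_sum_inner_smul` — `L u = ∑_k ⟪e_k, u⟫ L e_k` (expansion in the basis);
* `contDiffOn_succ_of_fderiv_apply_basis` — if every `∂_k v` is `Cⁿ` on `s` then `v` is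
  `C^{n+1}` on `s` (Mathlib's `contDiffOn_succ_of_fderiv_apply` asks this for `x ↦ Dv(x) u` for
  ALL vectors `u`; expand `u` in the basis);
* `iteratedFDeriv_succ_apply_eq_of_isOpen` — for `v ∈ C^{n+1}(s)` and `x ∈ s`,
  `D^{n+1}v(x)(m₀, …, m_n) = Dⁿ[y ↦ Dv(y) m_n](x)(m₀, …, m_{n-1})`
  (Mathlib's `iteratedFDeriv_succ_apply_right` and `iteratedFDerivWithin_clm_apply_const_apply`,
  localised to the open set);
* `norm_iteratedFDeriv_succ_le_of_partials`, `holderOnWith_iteratedFDeriv_succ_of_partials` —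
  (real-valued `v`) sup and Hölder bounds of the `Dⁿ ∂_k v` on `s` give the bounds
  `(card ι)^{n+1} B`, `(card ι)^{n+1} C` for `D^{n+1} v` on `s` (operator norms from components,
  `Literature/Analysis/Calculus/MultilinearComponentBounds.lean`);
* `contDiffOn_succ_and_bounds_of_partials` — the three packaged in the quantifier order of the
  tree's Schauder files (balls).

This is the bookkeeping that closes a difference-quotient regularity step: uniform `C^{n,α}`
bounds for the difference quotients of `v` pass to the limits `∂_k v`
(`Literature/Analysis/FunctionSpaces/HolderBallLimit.lean`), and this file turns "every `∂_k v` is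
`C^{n,α}`" into "`v` is `C^{n+1,α}`" with bounds (Gilbarg–Trudinger 2001, end of the proof of
Lemma 17.16). Everything is proved; no named facts.

## References

* D. Gilbarg, N. S. Trudinger, *Elliptic Partial Differential Equations of Second Order*,
  Classics in Mathematics, Springer 2001, §17.4, proof of Lemma 17.16. [GilbargTrudinger2001]
* J. Dieudonné, *Foundations of Modern Analysis*, Academic Press 1960, (8.12.7)–(8.12.10).
  [Dieudonne1960]
-/

noncomputable section

open Set Function Metric
open scoped NNReal ContDiff InnerProductSpace

namespace Literature.Analysis.Calculus

variable {ι : Type*} [Fintype ι] {E : Type*} [NormedAddCommGroup E] [InnerProductSpace ℝ E]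
  {F : Type*} [NormedAddCommGroup F] [NormedSpace ℝ F]

/-- **Expansion in an orthonormal basis under a continuous linear map**:
`L u = ∑_k ⟪e_k, u⟫ • L e_k`. [folklore] -/
theorem clm_apply_eq_sum_inner_smul (bE : OrthonormalBasis ι ℝ E) (L : E →L[ℝ] F) (u : E) :
    L u = ∑ k, ⟪bE k, u⟫_ℝ • L (bE k) := by
  conv_lhs => rw [← bE.sum_repr' u]
  rw [map_sum]
  simp_rw [map_smul]

/-- **`C^{n+1}` from `Cⁿ` partial derivatives**: on an open set `s`, if `v` is differentiable and
every partial derivative `x ↦ Dv(x) e_k` along an orthonormal basis is `Cⁿ` on `s`, then `v` is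
`C^{n+1}` on `s` (for every vector `u`, `x ↦ Dv(x) u = ∑_k ⟪e_k, u⟫ Dv(x) e_k` is `Cⁿ`; Mathlib's
`contDiffOn_succ_of_fderiv_apply`). [folklore] -/
theorem contDiffOn_succ_of_fderiv_apply_basis [FiniteDimensional ℝ E] (bE : OrthonormalBasis ι ℝ E)
    {v : E → F} {s : Set E} (hs : IsOpen s) {n : ℕ} (hv : DifferentiableOn ℝ v s)
    (h : ∀ k, ContDiffOn ℝ n (fun x => fderiv ℝ v x (bE k)) s) :
    ContDiffOn ℝ (n + 1 : ℕ) v s := by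
  rw [Nat.cast_succ]
  refine contDiffOn_succ_of_fderiv_apply hv
    (fun h' => absurd h' (by exact_mod_cast WithTop.coe_ne_top)) fun u => ?_
  have hsum : ContDiffOn ℝ n (fun x => ∑ k, ⟪bE k, u⟫_ℝ • fderiv ℝ v x (bE k)) s :=
    ContDiffOn.sum fun k _ => contDiffOn_const.smul (h k)
  refine hsum.congr fun x hx => ?_
  rw [fderivWithin_of_isOpen hs hx]
  exact clm_apply_eq_sum_inner_smul bE (fderiv ℝ v x) u

/-- **The last slot of `D^{n+1}v` is a partial derivative**: for `v ∈ C^{n+1}(s)`, `s` open,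
`x ∈ s`: `D^{n+1}v(x)(m) = Dⁿ[y ↦ Dv(y) (m n)](x)(m₀, …, m_{n-1})` (Mathlib's
`iteratedFDeriv_succ_apply_right`, and evaluation at a fixed vector commutes with
`iteratedFDerivWithin` on the open set, `iteratedFDerivWithin_clm_apply_const_apply`).
[folklore] -/
theorem iteratedFDeriv_succ_apply_eq_of_isOpen {v : E → F} {s : Set E} (hs : IsOpen s) {n : ℕ}
    (hv : ContDiffOn ℝ (n + 1 : ℕ) v s) {x : E} (hx : x ∈ s) (m : Fin (n + 1) → E) :
    iteratedFDeriv ℝ (n + 1) v x m =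
      iteratedFDeriv ℝ n (fun y => fderiv ℝ v y (m (Fin.last n))) x (Fin.init m) := by
  have hfd : ContDiffOn ℝ n (fun y => fderiv ℝ v y) s :=
    hv.fderiv_of_isOpen hs (by rw [Nat.cast_succ])
  rw [iteratedFDeriv_succ_apply_right,
    ← iteratedFDerivWithin_of_isOpen (f := fun y => fderiv ℝ v y) n hs hx,
    ← iteratedFDerivWithin_of_isOpen (f := fun y => fderiv ℝ v y (m (Fin.last n))) n hs hx]
  exact (iteratedFDerivWithin_clm_apply_const_apply hs.uniqueDiffOn hfd le_rfl hx).symm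

/-- The components of `D^{n+1}v` in the basis are components of the `Dⁿ ∂_k v`:
`D^{n+1}v(x)(e_{I 0}, …, e_{I n}) = Dⁿ[∂_{I n} v](x)(e_{I 0}, …, e_{I (n-1)})`. [folklore] -/
theorem iteratedFDeriv_succ_apply_basis_eq_of_isOpen (bE : OrthonormalBasis ι ℝ E) {v : E → F}
    {s : Set E} (hs : IsOpen s) {n : ℕ} (hv : ContDiffOn ℝ (n + 1 : ℕ) v s) {x : E} (hx : x ∈ s)
    (I : Fin (n + 1) → ι) :
    iteratedFDeriv ℝ (n + 1) v x (fun k => bE (I k)) =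
      iteratedFDeriv ℝ n (fun y => fderiv ℝ v y (bE (I (Fin.last n)))) x
        (fun k => bE (I (Fin.castSucc k))) :=
  iteratedFDeriv_succ_apply_eq_of_isOpen hs hv hx _

/-- `|A(e_{I 0}, …, e_{I (n-1)})| ≤ ‖A‖` for an `n`-linear form and unit basis vectors. [folklore] -/
theorem abs_apply_basis_le_norm (bE : OrthonormalBasis ι ℝ E) {n : ℕ} (A : E [×n]→L[ℝ] ℝ)
    (I : Fin n → ι) : |A (fun k => bE (I k))| ≤ ‖A‖ := by
  rw [← Real.norm_eq_abs]
  refine (A.le_opNorm _).trans_eq ?_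
  rw [Finset.prod_eq_one (fun k _ => bE.orthonormal.1 (I k)), mul_one]

/-- **Sup bound of `D^{n+1}v` from sup bounds of the `Dⁿ ∂_k v`** (real-valued `v ∈ C^{n+1}(s)`,
`s` open): `‖Dⁿ ∂_k v‖ ≤ B` on `s` for all `k` gives `‖D^{n+1} v‖ ≤ (card ι)^{n+1} B` on `s`.
[folklore] -/
theorem norm_iteratedFDeriv_succ_le_of_partials (bE : OrthonormalBasis ι ℝ E) {v : E → ℝ}
    {s : Set E} (hs : IsOpen s) {n : ℕ} (hv : ContDiffOn ℝ (n + 1 : ℕ) v s) {B : ℝ}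
    (hB : ∀ k, ∀ x ∈ s, ‖iteratedFDeriv ℝ n (fun y => fderiv ℝ v y (bE k)) x‖ ≤ B) :
    ∀ x ∈ s, ‖iteratedFDeriv ℝ (n + 1) v x‖ ≤ (Fintype.card ι) ^ (n + 1) * B :=
  norm_multilinear_le_of_components bE fun I x hx => by
    rw [iteratedFDeriv_succ_apply_basis_eq_of_isOpen bE hs hv hx I]
    exact (abs_apply_basis_le_norm bE _ _).trans (hB _ x hx)

/-- **Hölder bound of `D^{n+1}v` from Hölder bounds of the `Dⁿ ∂_k v`** (real-valued
`v ∈ C^{n+1}(s)`, `s` open): if every `Dⁿ ∂_k v` is `(C, α)`-Hölder on `s` then `D^{n+1} v` is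
`((card ι)^{n+1} C, α)`-Hölder on `s`. [folklore] -/
theorem holderOnWith_iteratedFDeriv_succ_of_partials (bE : OrthonormalBasis ι ℝ E) {v : E → ℝ}
    {s : Set E} (hs : IsOpen s) {n : ℕ} (hv : ContDiffOn ℝ (n + 1 : ℕ) v s) {C α : ℝ≥0}
    (hC : ∀ k, HolderOnWith C α (iteratedFDeriv ℝ n (fun y => fderiv ℝ v y (bE k))) s) :
    HolderOnWith ((Fintype.card ι) ^ (n + 1) * C) α (iteratedFDeriv ℝ (n + 1) v) s := by
  refine holderOnWith_multilinear_of_components bE fun I x hx y hy => ?_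
  simp only [iteratedFDeriv_succ_apply_basis_eq_of_isOpen bE hs hv hx I,
    iteratedFDeriv_succ_apply_basis_eq_of_isOpen bE hs hv hy I]
  refine le_trans ?_ (hC (I (Fin.last n)) x hx y hy)
  rw [edist_dist, edist_dist, Real.dist_eq, dist_eq_norm, ← sub_apply]
  exact ENNReal.ofReal_le_ofReal ((abs_apply_basis_le_norm bE _ _))

/-- **One more derivative, with bounds, from the partial derivatives (balls).** If `v` is
differentiable on `B(x₀, R)` and every partial derivative `∂_k v = (y ↦ Dv(y) e_k)` along an
orthonormal basis is `Cⁿ` there with `‖Dʲ ∂_k v‖ ≤ B` (`j ≤ n`) and `[Dⁿ ∂_k v]_α ≤ C`, then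
`v ∈ C^{n+1}(B(x₀, R))`, `‖D^{j+1} v‖ ≤ (card ι)^{j+1} B` for `j ≤ n` and
`[D^{n+1} v]_α ≤ (card ι)^{n+1} C` on `B(x₀, R)` (Gilbarg–Trudinger 2001, end of the proof of
Lemma 17.16: "hence `u ∈ C^{3,α}`"). [folklore] -/
theorem contDiffOn_succ_and_bounds_of_partials [FiniteDimensional ℝ E]
    (bE : OrthonormalBasis ι ℝ E) {v : E → ℝ} {x₀ : E} {R : ℝ} {n : ℕ} {B : ℝ} {C α : ℝ≥0}
    (hv : DifferentiableOn ℝ v (ball x₀ R))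
    (h : ∀ k, ContDiffOn ℝ n (fun y => fderiv ℝ v y (bE k)) (ball x₀ R))
    (hB : ∀ k, ∀ y ∈ ball x₀ R, ∀ j ≤ n, ‖iteratedFDeriv ℝ j (fun y => fderiv ℝ v y (bE k)) y‖ ≤ B)
    (hC : ∀ k, HolderOnWith C α (iteratedFDeriv ℝ n (fun y => fderiv ℝ v y (bE k))) (ball x₀ R)) :
    ContDiffOn ℝ (n + 1 : ℕ) v (ball x₀ R) ∧
      (∀ y ∈ ball x₀ R, ∀ j ≤ n,
        ‖iteratedFDeriv ℝ (j + 1) v y‖ ≤ (Fintype.card ι) ^ (j + 1) * B) ∧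
      HolderOnWith ((Fintype.card ι) ^ (n + 1) * C) α (iteratedFDeriv ℝ (n + 1) v) (ball x₀ R) := by
  have hv' : ContDiffOn ℝ (n + 1 : ℕ) v (ball x₀ R) :=
    contDiffOn_succ_of_fderiv_apply_basis bE isOpen_ball hv h
  refine ⟨hv', fun y hy j hj => ?_, holderOnWith_iteratedFDeriv_succ_of_partials bE isOpen_ball hv' hC⟩
  have hvj : ContDiffOn ℝ (j + 1 : ℕ) v (ball x₀ R) := hv'.of_le (by exact_mod_cast Nat.succ_le_succ hj)
  exact norm_iteratedFDeriv_succ_le_of_partials bE isOpen_ball hvj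
    (fun k x hx => hB k x hx j hj) y hy

end Literature.Analysis.Calculus
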